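import Summits.CriticalPhenomena.PercolationContinuityZ3.Theorems.PercNearOneGluingNoHeavyLowerTailKnQuestion8CoefficientwiseMirror
import HarnessLib

/-!
# Conjecture GRAND (mirror positive association of the two cluster pairs): the one-sided cell theorem

Support file (`--supports stmt-CriticalPhenomena-4575`, closed), prover `prim-cplus-coupling` (gen 28).  No definitions, no notations, no named
facts, no sorries; standard axioms.  Memo `prim-cplus-coupling/A5-COUPLING-gen28.md` §1 (GRAND), §2.

Setting as in …CoefficientwiseMirror: colourings `s : Finset ι`, `C_v(s) = openCluster (ends '' s) v`, `X = (C_x s, C_x sᶜ)`, `Y = (C_z s, C_z sᶜ)`, swap `s ↦ sᶜ`.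
CONJECTURE GRAND (gen 28; the complete two-colouring shadow of vdBHK's Theorems 1.3 and 1.5 for two independent copies): for `x ≠ z`, on
`S = {z ∉ C_x s} ∩ {z ∉ C_x sᶜ}`, and for `F, G : (K, L, Z_R, Z_B) ↦ ℝ` monotone in the GRAND ORDER (`K ↑, L ↓, Z_R ↓, Z_B ↑`),
  `0 ≤ Σ_{s ∈ S} (F(Q s) − F(Q sᶜ))·(G(Q s) − G(Q sᶜ))`,  `Q s := (C_x s, C_x sᶜ, C_z s, C_z sᶜ)`  (note `Q sᶜ` is the swapped quadruple);
equivalently `#S(𝔘 ∩ 𝔙) ≥ #S(𝔘 ∩ 𝔙^swap)` for grand up-sets.  It contains SUPER (F, G independent of the z-pair) and CROSS.  Exact census: 0 violations on all graphs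
with ≤ 6 vertices (1.88·10⁶ closure problems) and samples beyond (memo §3).  This file proves the one-sided case
(avoided vertex set `A`, test functions allowed to depend on the red cluster of `A`); the companion …CoefficientwiseGrandPendant derives GRAND for a pendant `z`.
* `Coefficientwise.grand_cell_nonneg` — abstract cell lemma: on a cell, for `Φᵢ(t) = Fᵢ(K t, K tᶜ) − Fᵢ♯(K tᶜ, K t)` with `Fᵢ, Fᵢ♯` twisted-monotone and
  `Fᵢ ≤ Fᵢ♯`, `0 ≤ Σ_{cell} Φ₁Φ₂` (both cell sums are `≤ 0` via the free flip; Harris);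
* `Coefficientwise.grand_offCluster_nonneg` — the one-sided theorem: for a vertex set `A` and test functions `Fᵢ ≤ Fᵢ♯` that may depend (arbitrarily) on the red
  cluster `R_A(s)` of `A` (constant on cells), `0 ≤ Σ_{s : A ∩ C_x s = ∅} (F₁(X,R) − F₁♯(X^sw,R))·(F₂(X,R) − F₂♯(X^sw,R))`.  With `Fᵢ = Fᵢ♯` independent of `R` and
  antisymmetrised this is `mirror_offCluster_nonneg` (…CoefficientwiseMirror).
[cite: KozmaNitzan2024, Questions 8–9 (§5.5 p. 36) (context: the Question-8 pocket covariance programme)]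
-/

namespace Summit.CriticalPhenomena.PercolationContinuityZ3.Theorems

open Finset Literature.Probability.Percolation

namespace Coefficientwise

variable {ι V : Type*}

section cells
variable [Fintype ι] [DecidableEq ι]

/-- **Grand cell lemma.**  `π ⊆ B`; `K` monotone with `K t ⊆ K ((B \ π) ∪ (t \ B))` on the cell; for `i = 1,2`, `Fᵢ, Fᵢ♯ : Set V → Set V → ℝ` monotone in the first
and antitone in the second argument with `Fᵢ ≤ Fᵢ♯` pointwise.  Then `0 ≤ Σ_{cell} (F₁(K t,K tᶜ) − F₁♯(K tᶜ,K t))·(F₂(K t,K tᶜ) − F₂♯(K tᶜ,K t))`. [this work] -/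
theorem grand_cell_nonneg (B π : Finset ι) (hπ : π ⊆ B) (K : Finset ι → Set V) (hK : Monotone K)
    (hKle : ∀ t : Finset ι, t ∩ B = π → K t ⊆ K ((B \ π) ∪ (t \ B)))
    (F₁ F₁' F₂ F₂' : Set V → Set V → ℝ)
    (m₁ : ∀ a a' b, a ⊆ a' → F₁ a b ≤ F₁ a' b) (n₁ : ∀ a b b', b ⊆ b' → F₁ a b' ≤ F₁ a b)
    (m₁' : ∀ a a' b, a ⊆ a' → F₁' a b ≤ F₁' a' b) (n₁' : ∀ a b b', b ⊆ b' → F₁' a b' ≤ F₁' a b) (le₁ : ∀ a b, F₁ a b ≤ F₁' a b)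
    (m₂ : ∀ a a' b, a ⊆ a' → F₂ a b ≤ F₂ a' b) (n₂ : ∀ a b b', b ⊆ b' → F₂ a b' ≤ F₂ a b)
    (m₂' : ∀ a a' b, a ⊆ a' → F₂' a b ≤ F₂' a' b) (n₂' : ∀ a b b', b ⊆ b' → F₂' a b' ≤ F₂' a b) (le₂ : ∀ a b, F₂ a b ≤ F₂' a b) :
    0 ≤ ∑ t ∈ univ.filter (fun t : Finset ι => t ∩ B = π),
      (F₁ (K t) (K tᶜ) - F₁' (K tᶜ) (K t)) * (F₂ (K t) (K tᶜ) - F₂' (K tᶜ) (K t)) := by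
  set cell := univ.filter (fun t : Finset ι => t ∩ B = π) with hcell
  have mem_cell : ∀ t : Finset ι, t ∈ cell ↔ t ∩ B = π := fun t => by simp [hcell]
  set Φ : Finset ι → ℝ := fun t => F₁ (K t) (K tᶜ) - F₁' (K tᶜ) (K t) with hΦ
  set Ψ : Finset ι → ℝ := fun t => F₂ (K t) (K tᶜ) - F₂' (K tᶜ) (K t) with hΨ
  have hΦm : Monotone Φ := fun s t hst => by
    simp only [hΦ]
    have h1 := m₁ _ _ (K tᶜ) (hK hst)
    have h2 := n₁ (K s) _ _ (hK (compl_subset_compl.mpr hst))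
    have h3 := m₁' _ _ (K s) (hK (compl_subset_compl.mpr hst))
    have h4 := n₁' (K tᶜ) _ _ (hK hst)
    linarith
  have hΨm : Monotone Ψ := fun s t hst => by
    simp only [hΨ]
    have h1 := m₂ _ _ (K tᶜ) (hK hst)
    have h2 := n₂ (K s) _ _ (hK (compl_subset_compl.mpr hst))
    have h3 := m₂' _ _ (K s) (hK (compl_subset_compl.mpr hst))
    have h4 := n₂' (K tᶜ) _ _ (hK hst)
    linarith
  -- the flip of the free coordinates
  set τ : Finset ι → Finset ι := fun t => π ∪ (tᶜ \ B) with hτ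
  have facts : ∀ t : Finset ι, t ∩ B = π → ∀ i, (i ∈ π ↔ i ∈ t ∧ i ∈ B) := fun t ht i => by
    rw [← ht]; exact Finset.mem_inter
  have memτ : ∀ t i, i ∈ τ t ↔ i ∈ π ∨ (i ∉ t ∧ i ∉ B) := fun t i => by
    simp only [hτ, Finset.mem_union, Finset.mem_sdiff, Finset.mem_compl]
  have hτcell : ∀ t, t ∩ B = π → τ t ∩ B = π := by
    intro t ht; ext i; simp only [Finset.mem_inter, memτ]
    have h1 := facts t ht i; have h2 : i ∈ π → i ∈ B := fun h => hπ h; tauto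
  have hττ : ∀ t, t ∩ B = π → τ (τ t) = t := by
    intro t ht; ext i; rw [memτ, memτ]
    have h1 := facts t ht i; have h2 : i ∈ π → i ∈ B := fun h => hπ h; tauto
  have hflip : ∀ t, t ∩ B = π → tᶜ = (B \ π) ∪ (τ t \ B) := by
    intro t ht; ext i; simp only [Finset.mem_compl, Finset.mem_union, Finset.mem_sdiff, memτ]
    have h1 := facts t ht i; have h2 : i ∈ π → i ∈ B := fun h => hπ h; tauto
  have hKτ : ∀ t, t ∩ B = π → K (τ t) ⊆ K tᶜ := by
    intro t ht; have h := hKle (τ t) (hτcell t ht); rw [← hflip t ht] at h; exact h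
  have hKτc : ∀ t, t ∩ B = π → K t ⊆ K (τ t)ᶜ := by
    intro t ht
    have e : (τ t)ᶜ = (B \ π) ∪ (t \ B) := by
      have := hflip (τ t) (hτcell t ht); rw [hττ t ht] at this; exact this
    rw [e]; exact hKle t ht
  -- cell sums are `≤ 0`
  have sum_le : ∀ (F F' : Set V → Set V → ℝ), (∀ a a' b, a ⊆ a' → F a b ≤ F a' b) → (∀ a b b', b ⊆ b' → F a b' ≤ F a b) →
      (∀ a b, F a b ≤ F' a b) → ∑ t ∈ cell, (F (K t) (K tᶜ) - F' (K tᶜ) (K t)) ≤ 0 := by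
    intro F F' m n le
    have reindex : ∑ t ∈ cell, F (K (τ t)) (K (τ t)ᶜ) = ∑ t ∈ cell, F (K t) (K tᶜ) := by
      refine Finset.sum_bij' (fun t _ => τ t) (fun t _ => τ t) ?_ ?_ ?_ ?_ ?_
      · intro t ht; exact (mem_cell _).mpr (hτcell t ((mem_cell t).mp ht))
      · intro t ht; exact (mem_cell _).mpr (hτcell t ((mem_cell t).mp ht))
      · intro t ht; exact hττ t ((mem_cell t).mp ht)
      · intro t ht; exact hττ t ((mem_cell t).mp ht)
      · intro t ht; rfl
    have hle : ∀ t ∈ cell, F (K (τ t)) (K (τ t)ᶜ) ≤ F' (K tᶜ) (K t) := by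
      intro t ht
      have ht' := (mem_cell t).mp ht
      calc F (K (τ t)) (K (τ t)ᶜ) ≤ F (K tᶜ) (K (τ t)ᶜ) := m _ _ _ (hKτ t ht')
        _ ≤ F (K tᶜ) (K t) := n _ _ _ (hKτc t ht')
        _ ≤ F' (K tᶜ) (K t) := le _ _
    rw [Finset.sum_sub_distrib, ← reindex, sub_nonpos]
    exact Finset.sum_le_sum hle
  have hΦs : ∑ t ∈ cell, Φ t ≤ 0 := sum_le F₁ F₁' m₁ n₁ le₁
  have hΨs : ∑ t ∈ cell, Ψ t ≤ 0 := sum_le F₂ F₂' m₂ n₂ le₂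
  have key := fkg_cell B π Φ Ψ hΦm hΨm
  have hprod : 0 ≤ (∑ t ∈ cell, Φ t) * (∑ t ∈ cell, Ψ t) := mul_nonneg_of_nonpos_of_nonpos hΦs hΨs
  rcases cell.eq_empty_or_nonempty with hce | hne
  · simp [hce]
  · have hcard : (0 : ℝ) < (cell.card : ℝ) := by exact_mod_cast hne.card_pos
    have h1 : 0 ≤ (cell.card : ℝ) * ∑ t ∈ cell, Φ t * Ψ t := le_trans hprod key
    have h2 : 0 ≤ ∑ t ∈ cell, Φ t * Ψ t := by
      by_contra hlt
      have hlt' : ∑ t ∈ cell, Φ t * Ψ t < 0 := lt_of_not_ge hlt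
      have : (cell.card : ℝ) * ∑ t ∈ cell, Φ t * Ψ t < 0 := mul_neg_of_pos_of_neg hcard hlt'
      linarith
    simpa [hΦ, hΨ] using h2

open Classical in
/-- **One-sided grand sum with cell-dependent test functions.**  For a vertex set `A` and `Fᵢ, Fᵢ♯ : Set V → Set V → Set V → ℝ` (third argument: the red
cluster `R_A(s)` of `A`) that are monotone in the first and antitone in the second argument with `Fᵢ ≤ Fᵢ♯`,
`0 ≤ Σ_{s : A ∩ C_x s = ∅} (F₁(C_x s, C_x sᶜ, R) − F₁♯(C_x sᶜ, C_x s, R))·(F₂(…) − F₂♯(…))`, `R = R_A(s)`. [this work] -/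
theorem grand_offCluster_nonneg (ends : ι → Sym2 V) (x : V) (A : Set V) (F₁ F₁' F₂ F₂' : Set V → Set V → Set V → ℝ)
    (m₁ : ∀ a a' b S, a ⊆ a' → F₁ a b S ≤ F₁ a' b S) (n₁ : ∀ a b b' S, b ⊆ b' → F₁ a b' S ≤ F₁ a b S)
    (m₁' : ∀ a a' b S, a ⊆ a' → F₁' a b S ≤ F₁' a' b S) (n₁' : ∀ a b b' S, b ⊆ b' → F₁' a b' S ≤ F₁' a b S) (le₁ : ∀ a b S, F₁ a b S ≤ F₁' a b S)
    (m₂ : ∀ a a' b S, a ⊆ a' → F₂ a b S ≤ F₂ a' b S) (n₂ : ∀ a b b' S, b ⊆ b' → F₂ a b' S ≤ F₂ a b S)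
    (m₂' : ∀ a a' b S, a ⊆ a' → F₂' a b S ≤ F₂' a' b S) (n₂' : ∀ a b b' S, b ⊆ b' → F₂' a b' S ≤ F₂' a b S) (le₂ : ∀ a b S, F₂ a b S ≤ F₂' a b S) :
    0 ≤ ∑ s ∈ univ.filter (fun s : Finset ι => ∀ a ∈ A, a ∉ openCluster (ends '' (↑s : Set ι)) x),
      (F₁ (openCluster (ends '' (↑s : Set ι)) x) (openCluster (ends '' (↑(sᶜ) : Set ι)) x) {y | ∃ a ∈ A, y ∈ openCluster (ends '' (↑s : Set ι)) a}
        - F₁' (openCluster (ends '' (↑(sᶜ) : Set ι)) x) (openCluster (ends '' (↑s : Set ι)) x) {y | ∃ a ∈ A, y ∈ openCluster (ends '' (↑s : Set ι)) a}) *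
      (F₂ (openCluster (ends '' (↑s : Set ι)) x) (openCluster (ends '' (↑(sᶜ) : Set ι)) x) {y | ∃ a ∈ A, y ∈ openCluster (ends '' (↑s : Set ι)) a}
        - F₂' (openCluster (ends '' (↑(sᶜ) : Set ι)) x) (openCluster (ends '' (↑s : Set ι)) x) {y | ∃ a ∈ A, y ∈ openCluster (ends '' (↑s : Set ι)) a}) := by
  set K : Finset ι → Set V := fun s => openCluster (ends '' (↑s : Set ι)) x with hK
  set R : Finset ι → Set V := fun s => {y | ∃ a ∈ A, y ∈ openCluster (ends '' (↑s : Set ι)) a} with hR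
  set D : Finset (Finset ι) := univ.filter (fun s : Finset ι => ∀ a ∈ A, a ∉ openCluster (ends '' (↑s : Set ι)) x) with hD
  change 0 ≤ ∑ s ∈ D, (F₁ (K s) (K sᶜ) (R s) - F₁' (K sᶜ) (K s) (R s)) * (F₂ (K s) (K sᶜ) (R s) - F₂' (K sᶜ) (K s) (R s))
  have hKmono : ∀ {s t : Finset ι}, s ⊆ t → K s ⊆ K t := fun hst => openCluster_image_mono ends hst x
  have hKm : Monotone K := fun s t hst => hKmono hst
  set I : Set V → Finset ι := fun S => univ.filter (fun i : ι => ∃ v ∈ S, v ∈ ends i) with hI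
  set key : Finset ι → Set V × Finset ι := fun s => (R s, s ∩ I (R s)) with hkey
  have R_closed : ∀ (s : Finset ι) {u w : V}, u ∈ R s → (openGraph (ends '' (↑s : Set ι))).Adj u w → w ∈ R s := by
    intro s u w hu hadj
    obtain ⟨a, haA, hau⟩ := hu
    exact ⟨a, haA, SimpleGraph.Reachable.trans hau hadj.reachable⟩
  have mem_I : ∀ (S : Set V) (i : ι) (v : V), v ∈ S → v ∈ ends i → i ∈ I S := by
    intro S i v hv hvi
    simp only [hI, Finset.mem_filter, Finset.mem_univ, true_and]
    exact ⟨v, hv, hvi⟩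
  have A_sub_R : ∀ (s : Finset ι), ∀ a ∈ A, a ∈ R s := fun s a ha => ⟨a, ha, mem_openCluster_self _ a⟩
  have locality : ∀ s₀ t : Finset ι, t ∩ I (R s₀) = s₀ ∩ I (R s₀) → R t = R s₀ := by
    intro s₀ t ht
    have agree : ∀ i, i ∈ I (R s₀) → (i ∈ t ↔ i ∈ s₀) := by
      intro i hi
      have := congrArg (fun u : Finset ι => i ∈ u) ht
      simp only [Finset.mem_inter, hi, and_true, eq_iff_iff] at this
      exact this
    have h1 : ∀ u ∈ R s₀, ∀ w, (openGraph (ends '' (↑s₀ : Set ι))).Adj u w →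
        (openGraph (ends '' (↑t : Set ι))).Adj u w ∧ w ∈ R s₀ := by
      intro u hu w hadj
      refine ⟨?_, R_closed s₀ hu hadj⟩
      rw [openGraph_image_adj] at hadj ⊢
      obtain ⟨⟨i, his, hi⟩, hne⟩ := hadj
      have hiI : i ∈ I (R s₀) := mem_I _ i u hu (by rw [hi]; exact Sym2.mem_mk_left u w)
      exact ⟨⟨i, (agree i hiI).mpr his, hi⟩, hne⟩
    have h2 : ∀ u ∈ R s₀, ∀ w, (openGraph (ends '' (↑t : Set ι))).Adj u w →
        (openGraph (ends '' (↑s₀ : Set ι))).Adj u w ∧ w ∈ R s₀ := by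
      intro u hu w hadj
      have hadj' : (openGraph (ends '' (↑s₀ : Set ι))).Adj u w := by
        rw [openGraph_image_adj] at hadj ⊢
        obtain ⟨⟨i, hit, hi⟩, hne⟩ := hadj
        have hiI : i ∈ I (R s₀) := mem_I _ i u hu (by rw [hi]; exact Sym2.mem_mk_left u w)
        exact ⟨⟨i, (agree i hiI).mp hit, hi⟩, hne⟩
      exact ⟨hadj', R_closed s₀ hu hadj'⟩
    ext y
    constructor
    · rintro ⟨a, haA, hay⟩
      obtain ⟨p⟩ := hay
      exact ((reachable_transfer (R s₀) h2 p) (A_sub_R s₀ a haA)).2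
    · rintro ⟨a, haA, hay⟩
      obtain ⟨p⟩ := hay
      exact ⟨a, haA, ((reachable_transfer (R s₀) h1 p) (A_sub_R s₀ a haA)).1⟩
  rw [← Finset.sum_fiberwise_of_maps_to (s := D) (t := D.image key) (g := key)
    (fun s hs => Finset.mem_image_of_mem key hs)]
  refine Finset.sum_nonneg fun k hk => ?_
  obtain ⟨s₀, hs₀D, rfl⟩ := Finset.mem_image.mp hk
  have hs₀ : ∀ a ∈ A, a ∉ K s₀ := by
    have := (Finset.mem_filter.mp hs₀D).2
    simpa [hK] using this
  set S₀ : Set V := R s₀ with hS₀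
  set B : Finset ι := I S₀ with hB
  set π : Finset ι := s₀ ∩ B with hπ
  have hxS₀ : x ∉ S₀ := by
    rintro ⟨a, haA, hax⟩
    exact hs₀ a haA (SimpleGraph.Reachable.symm hax)
  have fiber_eq : D.filter (fun t => key t = key s₀) = univ.filter (fun t : Finset ι => t ∩ B = π) := by
    ext t
    simp only [Finset.mem_filter, Finset.mem_univ, true_and]
    constructor
    · rintro ⟨_, hkt⟩
      have h1 : R t = S₀ := (Prod.ext_iff.mp hkt).1
      have h2 : t ∩ I (R t) = s₀ ∩ I (R s₀) := (Prod.ext_iff.mp hkt).2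
      rw [h1] at h2
      exact h2
    · intro ht
      have hRt : R t = S₀ := locality s₀ t ht
      refine ⟨?_, ?_⟩
      · rw [hD, Finset.mem_filter]
        refine ⟨Finset.mem_univ _, fun a haA hax => ?_⟩
        have hxRt : x ∈ R t := ⟨a, haA, SimpleGraph.Reachable.symm hax⟩
        rw [hRt] at hxRt
        exact hxS₀ hxRt
      · change (R t, t ∩ I (R t)) = (R s₀, s₀ ∩ I (R s₀))
        rw [hRt]
        exact Prod.ext rfl ht
  rw [fiber_eq]
  have offcluster : ∀ t : Finset ι, t ∩ B = π → K t ⊆ K ((B \ π) ∪ (t \ B)) := by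
    intro t ht
    have agree : ∀ i, i ∈ B → (i ∈ t ↔ i ∈ s₀) := by
      intro i hi
      have := congrArg (fun u : Finset ι => i ∈ u) ht
      simp only [hπ, Finset.mem_inter, hi, and_true, eq_iff_iff] at this
      exact this
    have htr : ∀ u ∈ S₀ᶜ, ∀ w, (openGraph (ends '' (↑t : Set ι))).Adj u w →
        (openGraph (ends '' (↑(t \ B) : Set ι))).Adj u w ∧ w ∈ S₀ᶜ := by
      intro u hu w hadj
      rw [openGraph_image_adj] at hadj
      obtain ⟨⟨i, hit, hi⟩, hne⟩ := hadj
      have hiB : i ∉ B := by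
        intro hiB
        have his₀ : i ∈ s₀ := (agree i hiB).mp hit
        have hiB' := hiB
        simp only [hB, hI, Finset.mem_filter, Finset.mem_univ, true_and] at hiB'
        obtain ⟨v, hvS, hvi⟩ := hiB'
        rw [hi, Sym2.mem_iff] at hvi
        rcases hvi with rfl | rfl
        · exact hu hvS
        · have hadj₀ : (openGraph (ends '' (↑s₀ : Set ι))).Adj v u := by
            rw [openGraph_image_adj]
            exact ⟨⟨i, his₀, by rw [hi, Sym2.eq_swap]⟩, hne.symm⟩
          exact hu (R_closed s₀ hvS hadj₀)
      have hwS : w ∈ S₀ᶜ := by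
        intro hwS
        exact hiB (mem_I S₀ i w hwS (by rw [hi]; exact Sym2.mem_mk_right u w))
      refine ⟨?_, hwS⟩
      rw [openGraph_image_adj]
      exact ⟨⟨i, Finset.mem_sdiff.mpr ⟨hit, hiB⟩, hi⟩, hne⟩
    intro y hy
    obtain ⟨p⟩ := hy
    have hreach := ((reachable_transfer S₀ᶜ htr p) hxS₀).1
    exact hKmono Finset.subset_union_right hreach
  -- on the cell the third argument is the constant `S₀`
  have hconst : ∀ t ∈ univ.filter (fun t : Finset ι => t ∩ B = π),
      (F₁ (K t) (K tᶜ) (R t) - F₁' (K tᶜ) (K t) (R t)) * (F₂ (K t) (K tᶜ) (R t) - F₂' (K tᶜ) (K t) (R t)) =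
      (F₁ (K t) (K tᶜ) S₀ - F₁' (K tᶜ) (K t) S₀) * (F₂ (K t) (K tᶜ) S₀ - F₂' (K tᶜ) (K t) S₀) := by
    intro t ht
    have ht' : t ∩ B = π := by simpa using ht
    rw [locality s₀ t ht']
  rw [Finset.sum_congr rfl hconst]
  exact grand_cell_nonneg B π Finset.inter_subset_right K hKm offcluster
    (fun a b => F₁ a b S₀) (fun a b => F₁' a b S₀) (fun a b => F₂ a b S₀) (fun a b => F₂' a b S₀)
    (fun a a' b h => m₁ a a' b S₀ h) (fun a b b' h => n₁ a b b' S₀ h) (fun a a' b h => m₁' a a' b S₀ h) (fun a b b' h => n₁' a b b' S₀ h)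
    (fun a b => le₁ a b S₀)
    (fun a a' b h => m₂ a a' b S₀ h) (fun a b b' h => n₂ a b b' S₀ h) (fun a a' b h => m₂' a a' b S₀ h) (fun a b b' h => n₂' a b b' S₀ h)
    (fun a b => le₂ a b S₀)

end cells

end Coefficientwise

end Summit.CriticalPhenomena.PercolationContinuityZ3.Theorems
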